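import Summits.AtomisticToContinuum.Crystallization.Theorems.GappedShellCensusCleanLimitsHaveWindowsInplaneGain1

/-!
# `CleanLimitsHaveWindows` (stmt-AtomisticToContinuum-15932), line `Sketch`, stub `stub_inplaneGain`, helper 2:
# lattice sums over a triangular layer

Support file for the certified in-plane gain. With the site term `igE` and the in-plane form `igP` of helper 1:

* `ig_LI_eq`, `ig_inLayer_eq`: the layer interaction `layerInteraction V_LJ a H δ 1` and the punctured in-layer
  sum `inLayerInteraction V_LJ a` as the lattice sums `∑'_{p ∈ ℤ²} E(a² P_δ(p) + H²)` (wrappers of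
  `cvx_layerInteraction_eq`, `cake_layerInteraction_self`);
* `ig_summable_site`: summability of `p ↦ E(A P_δ(p) + T)` for `A > 0`, `T ≥ 0`, `δ ∈ {0, 1}`;
* `ig_box_tail`, `ig_box_le_tsum`: a lattice sum is bounded below by a certified box sum minus the tail of a
  majorant of the negative parts (the form in which all layer certificates are used);
* `ig_tsum_inv4_le`, `ig_tsum_inv3_le`: the generic bounds `∑ (P + T)⁻⁴ ≤ 9T⁻⁴ + (64/21)(1/3 + T)⁻³`,
  `∑ (P + T)⁻³ ≤ 9T⁻³ + (32/7)(1/3 + T)⁻²` (box `[-1,1]²` plus the square-shell tail of `…Convexity3`);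
* `ig_abs_LI_le`: the decay `|layerInteraction V_LJ a H δ 1| ≤ 5 / H⁴` for `4/5 ≤ a² ≤ H²`, `1 ≤ H²`, any `δ`.
-/

noncomputable section

namespace Summit.AtomisticToContinuum.Crystallization.Theorems.CleanHull

open Summit.AtomisticToContinuum.Crystallization.Theorems.LayeredHull
open Literature.MathematicalPhysics.StatisticalMechanics Finset

/-- Membership in the box. [folklore] -/
theorem ig_mem_igBox {N : ℕ} {p : ℤ × ℤ} : p ∈ igBox N ↔ |p.1| ≤ N ∧ |p.2| ≤ N := by
  unfold igBox; exact cvx_mem_box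

/-- Off the box `[-N, N]²` the sup norm is at least `N + 1`. [folklore] -/
theorem ig_not_mem_igBox {N : ℕ} {p : ℤ × ℤ} (hp : p ∉ igBox N) : (N : ℤ) + 1 ≤ max |p.1| |p.2| := by
  rw [ig_mem_igBox] at hp
  rcases not_and_or.1 hp with h | h
  · exact le_trans (by omega) (le_max_left _ _)
  · exact le_trans (by omega) (le_max_right _ _)

/-! ## The layer sums as lattice sums of the site term -/

/-- **The layer interaction as a lattice sum of site terms**:
`layerInteraction V_LJ a H δ 1 = ∑'_{p} E(a² P_δ(p) + H²)`. [folklore] -/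
theorem ig_LI_eq (a H : ℝ) (δ : ℤ) :
    layerInteraction lennardJones a H δ 1 = ∑' p : ℤ × ℤ, igE (a ^ 2 * igP δ p + H ^ 2) := by
  rw [cvx_layerInteraction_eq]; rfl

/-- **The punctured in-layer sum as a lattice sum of site terms** (the origin contributes `E(0) = 0`):
`inLayerInteraction V_LJ a = ∑'_{p} E(a² P_0(p))`. [folklore] -/
theorem ig_inLayer_eq (a : ℝ) : inLayerInteraction lennardJones a = ∑' p : ℤ × ℤ, igE (a ^ 2 * igP 0 p) := by
  rw [← cake_layerInteraction_self, ig_LI_eq]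
  refine tsum_congr fun p => ?_
  simp

/-! ## Summability of the site families -/

/-- `|E(q)| ≤ (1/12) q⁻⁶ + (1/6) q⁻³` for `q ≥ 0`. [folklore] -/
theorem ig_abs_E_le {q : ℝ} (hq : 0 ≤ q) : |igE q| ≤ 1 / 12 * (q⁻¹) ^ 6 + 1 / 6 * (q⁻¹) ^ 3 := by
  unfold igE
  have h6 : 0 ≤ (q⁻¹) ^ 6 := by positivity
  have h3 : 0 ≤ (q⁻¹) ^ 3 := by positivity
  rw [abs_le]; constructor <;> nlinarith

/-- `|E(q)| ≤ (1/4) q⁻³` for `q ≥ 1`. [folklore] -/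
theorem ig_abs_E_le_of_one_le {q : ℝ} (hq : 1 ≤ q) : |igE q| ≤ 1 / 4 * (q⁻¹) ^ 3 := by
  have h := ig_abs_E_le (by linarith : 0 ≤ q)
  have hu : (q⁻¹) ^ 3 ≤ 1 := pow_le_one₀ (by positivity) (inv_le_one_of_one_le₀ hq)
  have h0 : 0 ≤ (q⁻¹) ^ 3 := by positivity
  have h6 : (q⁻¹) ^ 6 = (q⁻¹) ^ 3 * (q⁻¹) ^ 3 := by ring
  nlinarith

/-- **Summability of the site family** `p ↦ E(A P_δ(p) + T)` over `ℤ²`, for `A > 0`, `T ≥ 0`, `δ ∈ {0,1}`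
(comparison with `((P + 1)⁻¹)³` off the box `[-1,1]²`). [folklore] -/
theorem ig_summable_site {A T : ℝ} (hA : 0 < A) (hT : 0 ≤ T) (δ : ℤ) (hδ : δ = 0 ∨ δ = 1) :
    Summable fun p : ℤ × ℤ => igE (A * igP δ p + T) := by
  set K : ℝ := 8 * (A⁻¹) ^ 3 * (1 / 12 * ((2 * A)⁻¹) ^ 3 + 1 / 6) with hK
  have hK0 : 0 ≤ K := by positivity
  -- the majorant `K ((P + 1)⁻¹)³` is summable
  have hmaj : Summable fun p : ℤ × ℤ => K * ((igP δ p + 1)⁻¹) ^ 3 := by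
    refine ((cvx_lattice_tsum_le (F := fun p : ℤ × ℤ => ((igP δ p + 1)⁻¹) ^ 3)
      (fun p => pow_nonneg (inv_nonneg.2 (by linarith [igP_nonneg δ p])) _)
      (N := 1) (n := 2) le_rfl (by norm_num) zero_le_one one_pos ?_).1).mul_left K
    intro p hp
    have hs := cvx_P_ge_shell δ hδ p (by omega)
    have hP := igP_nonneg δ p
    rw [one_mul]
    exact pow_le_pow_left₀ (inv_nonneg.2 (by linarith)) (inv_anti₀ (by positivity) (by unfold igP; linarith)) 3
  have hfin : Summable fun p : ℤ × ℤ => if p ∈ igBox 1 then |igE (A * igP δ p + T)| else 0 :=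
    summable_of_ne_finset_zero (s := igBox 1) fun p hp => if_neg hp
  refine Summable.of_norm_bounded (hmaj.add hfin) fun p => ?_
  rw [Real.norm_eq_abs]
  by_cases hp : p ∈ igBox 1
  · rw [if_pos hp]
    have hP := igP_nonneg δ p
    have : 0 ≤ K * ((igP δ p + 1)⁻¹) ^ 3 := by positivity
    linarith
  · rw [if_neg hp, add_zero]
    have hr := ig_not_mem_igBox hp
    have hs := cvx_P_ge_shell δ hδ p (by omega)
    have hr2 : (2 : ℝ) ≤ ((max |p.1| |p.2| : ℤ) : ℝ) := by exact_mod_cast hr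
    have hP2 : 2 ≤ igP δ p := by unfold igP; nlinarith
    set P := igP δ p with hPdef
    set q := A * P + T with hq
    have hq2A : 2 * A ≤ q := by rw [hq]; nlinarith
    have hq0 : 0 < q := by linarith
    have hqP : A * (P + 1) / 2 ≤ q := by rw [hq]; nlinarith
    have h1 := ig_abs_E_le hq0.le
    have hi3 : (q⁻¹) ^ 3 ≤ 8 * (A⁻¹) ^ 3 * ((P + 1)⁻¹) ^ 3 := by
      have : q⁻¹ ≤ (A * (P + 1) / 2)⁻¹ := inv_anti₀ (by positivity) hqP
      calc (q⁻¹) ^ 3 ≤ ((A * (P + 1) / 2)⁻¹) ^ 3 := pow_le_pow_left₀ (by positivity) this 3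
        _ = 8 * (A⁻¹) ^ 3 * ((P + 1)⁻¹) ^ 3 := by
            rw [show (A * (P + 1) / 2)⁻¹ = 2 * (A⁻¹ * (P + 1)⁻¹) by
              rw [div_eq_mul_inv, mul_inv, mul_inv, inv_inv]; ring]
            ring
    have hi6 : (q⁻¹) ^ 6 ≤ ((2 * A)⁻¹) ^ 3 * (q⁻¹) ^ 3 := by
      have : (q⁻¹) ^ 3 ≤ ((2 * A)⁻¹) ^ 3 := pow_le_pow_left₀ (by positivity) (inv_anti₀ (by positivity) hq2A) 3
      calc (q⁻¹) ^ 6 = (q⁻¹) ^ 3 * (q⁻¹) ^ 3 := by ring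
        _ ≤ ((2 * A)⁻¹) ^ 3 * (q⁻¹) ^ 3 := mul_le_mul_of_nonneg_right this (by positivity)
    have hpos : 0 ≤ 1 / 12 * ((2 * A)⁻¹) ^ 3 + 1 / 6 := by positivity
    calc |igE q| ≤ 1 / 12 * (q⁻¹) ^ 6 + 1 / 6 * (q⁻¹) ^ 3 := h1
      _ ≤ (1 / 12 * ((2 * A)⁻¹) ^ 3 + 1 / 6) * (q⁻¹) ^ 3 := by nlinarith
      _ ≤ (1 / 12 * ((2 * A)⁻¹) ^ 3 + 1 / 6) * (8 * (A⁻¹) ^ 3 * ((P + 1)⁻¹) ^ 3) :=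
          mul_le_mul_of_nonneg_left hi3 hpos
      _ = K * ((P + 1)⁻¹) ^ 3 := by rw [hK]; ring

/-- Summability of a layer family `p ↦ E(a² P_δ(p) + H²)` for `a ≠ 0` and `δ ∈ {0, 1}`. [folklore] -/
theorem ig_summable_layer {a : ℝ} (ha : a ≠ 0) (H : ℝ) (δ : ℤ) (hδ : δ = 0 ∨ δ = 1) :
    Summable fun p : ℤ × ℤ => igE (a ^ 2 * igP δ p + H ^ 2) :=
  ig_summable_site (by positivity) (sq_nonneg H) δ hδ

/-! ## Box sums and tails -/

/-- **A lattice sum is at least a box sum of termwise lower bounds minus the tail of a majorant of the negative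
parts off the box.** [folklore] -/
theorem ig_box_tail {t g n : ℤ × ℤ → ℝ} {N : ℕ} {R : ℝ} (ht : Summable t) (hn : Summable n)
    (hg : ∀ p ∈ igBox N, g p ≤ t p) (htn : ∀ p, p ∉ igBox N → -n p ≤ t p)
    (hR : ∑' p, n p ≤ ∑ p ∈ igBox N, n p + R) :
    ∑ p ∈ igBox N, g p - R ≤ ∑' p, t p := by
  have h1 := ht.sum_add_tsum_subtype_compl (igBox N)
  have h2 := hn.sum_add_tsum_subtype_compl (igBox N)
  have h3 : ∑' p : {p // p ∉ igBox N}, (-n p) ≤ ∑' p : {p // p ∉ igBox N}, t p :=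
    Summable.tsum_le_tsum (fun p => htn p p.2) (hn.subtype _).neg (ht.subtype _)
  rw [tsum_neg] at h3
  have h4 : ∑ p ∈ igBox N, g p ≤ ∑ p ∈ igBox N, t p := Finset.sum_le_sum hg
  linarith

/-- **A lattice sum of a family that is nonnegative off the box is at least the box sum of termwise lower
bounds.** [folklore] -/
theorem ig_box_le_tsum {t g : ℤ × ℤ → ℝ} {N : ℕ} (ht : Summable t) (hg : ∀ p ∈ igBox N, g p ≤ t p)
    (ht0 : ∀ p, p ∉ igBox N → 0 ≤ t p) : ∑ p ∈ igBox N, g p ≤ ∑' p, t p :=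
  (Finset.sum_le_sum hg).trans (ht.sum_le_tsum (igBox N) ht0)

/-- **Tail of an inverse-power majorant.** For `δ ∈ {0,1}`, `C ≥ 0`, `T > 0`, `n ≥ 1` and a shift `σ ≤ 0` hmm, the family
`C ((P_δ(p) + T)⁻¹)^(n+1)` is summable with
`∑' ≤ ∑_{[-N,N]²} + (32(N+1)/(n(6N+1))) C ((3/4)(N-1/3)² + T)⁻ⁿ`. [folklore] -/
theorem ig_tail_inv_pow (δ : ℤ) (hδ : δ = 0 ∨ δ = 1) {C T : ℝ} (hC : 0 ≤ C) (hT : 0 < T) {N n : ℕ}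
    (hN : 1 ≤ N) (hn : 1 ≤ n) :
    (Summable fun p : ℤ × ℤ => C * ((igP δ p + T)⁻¹) ^ (n + 1)) ∧
      ∑' p : ℤ × ℤ, C * ((igP δ p + T)⁻¹) ^ (n + 1) ≤ ∑ p ∈ igBox N, C * ((igP δ p + T)⁻¹) ^ (n + 1) +
        32 * ((N : ℝ) + 1) / (n * (6 * N + 1)) * C * ((3 / 4 * ((N : ℝ) - 1 / 3) ^ 2 + T)⁻¹) ^ n := by
  refine cvx_lattice_tsum_le (F := fun p : ℤ × ℤ => C * ((igP δ p + T)⁻¹) ^ (n + 1))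
    (fun p => mul_nonneg hC (pow_nonneg (inv_nonneg.2 (by linarith [igP_nonneg δ p])) _)) hN hn hC hT
    fun p hp => ?_
  have hs := cvx_P_ge_shell δ hδ p (by omega)
  have hP := igP_nonneg δ p
  exact mul_le_mul_of_nonneg_left
    (pow_le_pow_left₀ (by positivity) (inv_anti₀ (by positivity) (by unfold igP; linarith)) _) hC

/-- **Tail of the in-plane majorant** (aligned coset, no height): for `C ≥ 0`, `n ≥ 1`, the family
`C ((P_0(p))⁻¹)^(n+1)` (junk value `0` at the origin... rather: value `0` there since `0⁻¹ = 0`) is summable with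
`∑' ≤ ∑_{[-N,N]²} + (32(N+1)/(n(6N+1))) C ((3/4)(N-1/3)² + 5/12)⁻ⁿ`. [folklore] -/
theorem ig_tail_inv_pow_zero {C : ℝ} (hC : 0 ≤ C) {N n : ℕ} (hN : 1 ≤ N) (hn : 1 ≤ n) :
    (Summable fun p : ℤ × ℤ => C * ((igP 0 p)⁻¹) ^ (n + 1)) ∧
      ∑' p : ℤ × ℤ, C * ((igP 0 p)⁻¹) ^ (n + 1) ≤ ∑ p ∈ igBox N, C * ((igP 0 p)⁻¹) ^ (n + 1) +
        32 * ((N : ℝ) + 1) / (n * (6 * N + 1)) * C * ((3 / 4 * ((N : ℝ) - 1 / 3) ^ 2 + 5 / 12)⁻¹) ^ n := by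
  refine cvx_lattice_tsum_le (F := fun p : ℤ × ℤ => C * ((igP 0 p)⁻¹) ^ (n + 1))
    (fun p => mul_nonneg hC (pow_nonneg (inv_nonneg.2 (igP_nonneg 0 p)) _)) hN hn hC (by norm_num)
    fun p hp => ?_
  have hs := ig_P0_ge_shell p (by omega)
  exact mul_le_mul_of_nonneg_left
    (pow_le_pow_left₀ (inv_nonneg.2 (igP_nonneg 0 p)) (inv_anti₀ (by positivity) hs) _) hC

/-- The nine sites of the box `[-1,1]²` bound: `∑_{[-1,1]²} ((P + T)⁻¹)^m ≤ 9 (T⁻¹)^m`. [folklore] -/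
theorem ig_box_one_le (δ : ℤ) {T : ℝ} (hT : 0 < T) (m : ℕ) :
    ∑ p ∈ igBox 1, ((igP δ p + T)⁻¹) ^ m ≤ 9 * (T⁻¹) ^ m := by
  have hterm : ∀ p ∈ igBox 1, ((igP δ p + T)⁻¹) ^ m ≤ (T⁻¹) ^ m := fun p _ =>
    have hP := igP_nonneg δ p
    pow_le_pow_left₀ (by positivity) (inv_anti₀ hT (by linarith)) m
  have h := Finset.sum_le_card_nsmul _ _ _ hterm
  unfold igBox at h ⊢
  rw [cvx_card_box, nsmul_eq_mul] at h
  simpa using h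

/-- **Generic inverse-quartic lattice sum**: `∑_{ℤ²} ((P_δ + T)⁻¹)⁴ ≤ 9 T⁻⁴ + (64/21)(1/3 + T)⁻³` for `T > 0`,
`δ ∈ {0,1}`, and the family is summable. [folklore] -/
theorem ig_tsum_inv4_le (δ : ℤ) (hδ : δ = 0 ∨ δ = 1) {T : ℝ} (hT : 0 < T) :
    (Summable fun p : ℤ × ℤ => ((igP δ p + T)⁻¹) ^ 4) ∧
      ∑' p : ℤ × ℤ, ((igP δ p + T)⁻¹) ^ 4 ≤ 9 * (T⁻¹) ^ 4 + 64 / 21 * ((1 / 3 + T)⁻¹) ^ 3 := by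
  obtain ⟨hs, hle⟩ := ig_tail_inv_pow δ hδ zero_le_one hT (N := 1) (n := 3) le_rfl (by norm_num)
  simp only [one_mul] at hs hle
  refine ⟨hs, hle.trans ?_⟩
  have hbox := ig_box_one_le δ hT 4
  have e : (32 : ℝ) * (((1 : ℕ) : ℝ) + 1) / ((3 : ℕ) * (6 * ((1 : ℕ) : ℝ) + 1)) * 1 *
      ((3 / 4 * (((1 : ℕ) : ℝ) - 1 / 3) ^ 2 + T)⁻¹) ^ 3 = 64 / 21 * ((1 / 3 + T)⁻¹) ^ 3 := by norm_num
  rw [e]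
  linarith

/-- **Generic inverse-cubic lattice sum**: `∑_{ℤ²} ((P_δ + T)⁻¹)³ ≤ 9 T⁻³ + (32/7)(1/3 + T)⁻²` for `T > 0`,
`δ ∈ {0,1}`, and the family is summable. [folklore] -/
theorem ig_tsum_inv3_le (δ : ℤ) (hδ : δ = 0 ∨ δ = 1) {T : ℝ} (hT : 0 < T) :
    (Summable fun p : ℤ × ℤ => ((igP δ p + T)⁻¹) ^ 3) ∧
      ∑' p : ℤ × ℤ, ((igP δ p + T)⁻¹) ^ 3 ≤ 9 * (T⁻¹) ^ 3 + 32 / 7 * ((1 / 3 + T)⁻¹) ^ 2 := by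
  obtain ⟨hs, hle⟩ := ig_tail_inv_pow δ hδ zero_le_one hT (N := 1) (n := 2) le_rfl (by norm_num)
  simp only [one_mul] at hs hle
  refine ⟨hs, hle.trans ?_⟩
  have hbox := ig_box_one_le δ hT 3
  have e : (32 : ℝ) * (((1 : ℕ) : ℝ) + 1) / ((2 : ℕ) * (6 * ((1 : ℕ) : ℝ) + 1)) * 1 *
      ((3 / 4 * (((1 : ℕ) : ℝ) - 1 / 3) ^ 2 + T)⁻¹) ^ 2 = 32 / 7 * ((1 / 3 + T)⁻¹) ^ 2 := by norm_num
  rw [e]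
  linarith

/-! ## Decay of the layer sums -/

/-- **Decay of the Lennard-Jones layer interaction**: `|layerInteraction V_LJ a H δ 1| ≤ 5 / H⁴` whenever
`4/5 ≤ a² ≤ H²` and `1 ≤ H²` (any offset `δ`). [folklore] -/
theorem ig_abs_LI_le {a H : ℝ} (ha : 4 / 5 ≤ a ^ 2) (haH : a ^ 2 ≤ H ^ 2) (hH : 1 ≤ H ^ 2) (δ : ℤ) :
    |layerInteraction lennardJones a H δ 1| ≤ 5 / H ^ 4 := by
  -- reduce to the two cosets
  suffices key : ∀ δ' : ℤ, (δ' = 0 ∨ δ' = 1) → |layerInteraction lennardJones a H δ' 1| ≤ 5 / H ^ 4 by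
    rw [layerInteraction_eq_ite]
    split_ifs
    · exact key 0 (Or.inl rfl)
    · exact key 1 (Or.inr rfl)
  intro δ hδ
  have ha0 : 0 < a ^ 2 := by linarith
  have hane : a ≠ 0 := by rintro rfl; norm_num at ha0
  set T : ℝ := H ^ 2 / a ^ 2 with hT
  have hT1 : 1 ≤ T := by rw [hT, le_div_iff₀ ha0]; linarith
  have hT0 : 0 < T := by linarith
  obtain ⟨hs3, hle3⟩ := ig_tsum_inv3_le δ hδ hT0
  rw [ig_LI_eq]
  have hsum := ig_summable_layer hane H δ hδ
  -- termwise: |E(a²P + H²)| ≤ (1/4) a⁻⁶ ((P + T)⁻¹)³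
  have hterm : ∀ p : ℤ × ℤ, ‖igE (a ^ 2 * igP δ p + H ^ 2)‖ ≤ 1 / 4 * ((a ^ 2)⁻¹) ^ 3 * ((igP δ p + T)⁻¹) ^ 3 := by
    intro p
    rw [Real.norm_eq_abs]
    have hP := igP_nonneg δ p
    have hq : a ^ 2 * igP δ p + H ^ 2 = a ^ 2 * (igP δ p + T) := by rw [hT]; field_simp
    have hq1 : 1 ≤ a ^ 2 * igP δ p + H ^ 2 := by nlinarith
    calc |igE (a ^ 2 * igP δ p + H ^ 2)| ≤ 1 / 4 * ((a ^ 2 * igP δ p + H ^ 2)⁻¹) ^ 3 := ig_abs_E_le_of_one_le hq1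
      _ = 1 / 4 * ((a ^ 2)⁻¹) ^ 3 * ((igP δ p + T)⁻¹) ^ 3 := by rw [hq, mul_inv, mul_pow]; ring
  have h1 : ‖∑' p : ℤ × ℤ, igE (a ^ 2 * igP δ p + H ^ 2)‖ ≤
      ∑' p : ℤ × ℤ, 1 / 4 * ((a ^ 2)⁻¹) ^ 3 * ((igP δ p + T)⁻¹) ^ 3 :=
    tsum_of_norm_bounded (hs3.mul_left _).hasSum hterm
  rw [Real.norm_eq_abs, tsum_mul_left] at h1
  refine h1.trans ?_
  have hTinv : T⁻¹ ≤ 1 := inv_le_one_of_one_le₀ hT1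
  have hTi0 : 0 ≤ T⁻¹ := by positivity
  have h13 : ((1 / 3 + T)⁻¹) ^ 2 ≤ (T⁻¹) ^ 2 :=
    pow_le_pow_left₀ (by positivity) (inv_anti₀ hT0 (by linarith)) 2
  have hS : ∑' p : ℤ × ℤ, ((igP δ p + T)⁻¹) ^ 3 ≤ 95 / 7 * (T⁻¹) ^ 2 := by
    have : (T⁻¹) ^ 3 ≤ (T⁻¹) ^ 2 := by nlinarith [sq_nonneg (T⁻¹)]
    linarith
  have hTa : (T⁻¹) ^ 2 = (a ^ 2) ^ 2 / H ^ 4 := by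
    rw [hT, inv_div, div_pow]; ring
  have hH0 : 0 < H ^ 4 := by
    have : H ^ 4 = (H ^ 2) ^ 2 := by ring
    rw [this]; positivity
  calc 1 / 4 * ((a ^ 2)⁻¹) ^ 3 * ∑' p : ℤ × ℤ, ((igP δ p + T)⁻¹) ^ 3
      ≤ 1 / 4 * ((a ^ 2)⁻¹) ^ 3 * (95 / 7 * (T⁻¹) ^ 2) := mul_le_mul_of_nonneg_left hS (by positivity)
    _ = 95 / 28 * (a ^ 2)⁻¹ / H ^ 4 := by rw [hTa]; field_simp; ring
    _ ≤ 5 / H ^ 4 := by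
        rw [div_le_div_iff_of_pos_right hH0]
        have : (a ^ 2)⁻¹ ≤ 5 / 4 := by rw [inv_eq_one_div, div_le_div_iff₀ ha0 (by norm_num)]; linarith
        linarith

end Summit.AtomisticToContinuum.Crystallization.Theorems.CleanHull

end
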